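import Mathlib

set_option linter.dupNamespace false

/-!
# Joint freeness law, part B (lens 4, g29): the structured branch — bilinear normal form on a pair-free set, pencil substitution

Companion of part A (the greedy dichotomy).  On the STRUCTURED branch every pencil row `Σ_r θ r • S r j` (`j` in the popular
direction class `J_θ`) is a combination of the pencil rows indexed by the free set `I` and of the label rows `Λ q`, plus a light
vector `s j`; on a PAIR-FREE coordinate set `Fs ⊆ J_θ` (no light vector `s j`, `j ∈ Fs`, meets another point of `Fs` — chosen by
the first moment, tree `InnerDegreeDial.exists_card_avoiding`) the `θ`-member of the pencil of quadratic forms collapses: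
* `pencil_bilinear` — the identity `Σ_{j,l} v_j (Σ_r θ_r S r j l) v_l = Σ_{r,i} (Σ_j c j r i v_j)(Σ_l S r i l v_l)
  + Σ_q (Σ_j c' j q v_j)(Σ_l Λ q l v_l) + Σ_j s j j v_j v_j` for vectors `v` supported on `Fs`;
* `pencil_factor` — hence, at Boolean points, the `θ`-member is a FUNCTION OF `2·t·|I| + 2·k + 1` LINEAR FORMS
  (`card_pencilIndex`): the step «`q_θ` restricted to `Q_F` is a function of `K″ ≤ 2(2|I|+k)+1` forms» of `(c0)₂` step 4
  (NODE-g28 §5e; `t = 2`) and of `(c0)` (P5) (`t = 1`), for every `t`;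
* `pencil_solve` — PENCIL SUBSTITUTION (PS): if `θ r₀ ≠ 0` the `r₀`-th quadratic is an explicit function of the `θ`-member and
  the other `t − 1` quadratics, so a register reading `t` quadratics reads, on `Q_F`, `t − 1` quadratics and `K″` more forms —
  the induction step `s ↦ s − 1` of `(c0)_s` (S-PRIME §12).
Pure algebra over a field; no game object is mentioned.  Supports stmt-QuantumAdvantage-28487 (record; the residual
`X = AbsorptionDial.NoPerfectPolyOdd` is NOT claimed).
-/

namespace Summit.QuantumAdvantage.QuantumAdvantage.Theorems.JointFreeness

open Finset

variable {F : Type*} [Field F] {n t k : ℕ}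

section Bilinear

/-- **sum swap**: a bilinear expression whose middle matrix factors through an index type `X` is a sum over `X` of products of
two linear forms -/
theorem sum_bilinear_factor {X : Type*} [Fintype X] (a : Fin n → X → F) (b : X → Fin n → F) (v : Fin n → F) :
    (∑ j, ∑ l, v j * (∑ x, a j x * b x l) * v l) = ∑ x, (∑ j, a j x * v j) * (∑ l, b x l * v l) := by
  have h1 : ∀ x, (∑ j, a j x * v j) * (∑ l, b x l * v l) = ∑ j, ∑ l, v j * (a j x * b x l) * v l := by
    intro x
    rw [Finset.sum_mul_sum]
    exact Finset.sum_congr rfl fun j _ => Finset.sum_congr rfl fun l _ => by ring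
  rw [Finset.sum_congr rfl fun x _ => h1 x]
  simp only [Finset.mul_sum, Finset.sum_mul]
  rw [Finset.sum_congr rfl fun j _ => Finset.sum_comm, Finset.sum_comm]

variable (S : Fin t → Fin n → Fin n → F) (Λ : Fin k → Fin n → F) (θ : Fin t → F) (Fs : Finset (Fin n))
  (c : Fin n → Fin t → Fin n → F) (c' : Fin n → Fin k → F) (s : Fin n → Fin n → F)

/-- **bilinear normal form on a pair-free set.**  If for all `j, l ∈ Fs` the `θ`-pencil row at `j` reads
`Σ_r θ r S r j l = Σ_{r,i} c j r i S r i l + Σ_q c' j q Λ q l + s j l`, and the light parts are pair-free on `Fs`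
(`s j l = 0` for `l ≠ j` in `Fs`), then for every `v` supported on `Fs` the `θ`-member of the pencil of quadratic forms is a sum
of products of pairs of linear forms plus a diagonal term. -/
theorem pencil_bilinear
    (hrow : ∀ j ∈ Fs, ∀ l ∈ Fs, (∑ r, θ r * S r j l) = (∑ r, ∑ i, c j r i * S r i l) + (∑ q, c' j q * Λ q l) + s j l)
    (hpf : ∀ j ∈ Fs, ∀ l ∈ Fs, l ≠ j → s j l = 0) (v : Fin n → F) (hv : ∀ l, l ∉ Fs → v l = 0) :
    (∑ j, ∑ l, v j * (∑ r, θ r * S r j l) * v l) =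
      (∑ r, ∑ i, (∑ j, c j r i * v j) * (∑ l, S r i l * v l)) + (∑ q, (∑ j, c' j q * v j) * (∑ l, Λ q l * v l))
        + ∑ j, s j j * v j * v j := by
  -- replace the pencil row by its decomposition wherever `v j * v l ≠ 0`, writing the double sum `Σ_r Σ_i` over `Fin t × Fin n`
  have hterm : ∀ j l, v j * (∑ r, θ r * S r j l) * v l =
      v j * (∑ x : Fin t × Fin n, c j x.1 x.2 * S x.1 x.2 l) * v l + v j * (∑ q, c' j q * Λ q l) * v l
        + v j * s j l * v l := by
    intro j l
    rw [Fintype.sum_prod_type' (fun r i => c j r i * S r i l)]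
    by_cases hj : j ∈ Fs
    · by_cases hl : l ∈ Fs
      · rw [hrow j hj l hl]; ring
      · rw [hv l hl]; ring
    · rw [hv j hj]; ring
  have hdiag : ∀ j, ∑ l, v j * s j l * v l = s j j * v j * v j := by
    intro j
    rw [Finset.sum_eq_single j]
    · ring
    · intro l _ hlj
      by_cases hj : j ∈ Fs
      · by_cases hl : l ∈ Fs
        · rw [hpf j hj l hl hlj]; ring
        · rw [hv l hl]; ring
      · rw [hv j hj]; ring
    · intro h; exact absurd (mem_univ j) h
  calc (∑ j, ∑ l, v j * (∑ r, θ r * S r j l) * v l)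
      = (∑ j, ∑ l, v j * (∑ x : Fin t × Fin n, c j x.1 x.2 * S x.1 x.2 l) * v l)
          + (∑ j, ∑ l, v j * (∑ q, c' j q * Λ q l) * v l) + ∑ j, ∑ l, v j * s j l * v l := by
        rw [Finset.sum_congr rfl fun j _ => Finset.sum_congr rfl fun l _ => hterm j l]
        simp only [Finset.sum_add_distrib]
    _ = (∑ x : Fin t × Fin n, (∑ j, c j x.1 x.2 * v j) * (∑ l, S x.1 x.2 l * v l))
          + (∑ q, (∑ j, c' j q * v j) * (∑ l, Λ q l * v l)) + ∑ j, s j j * v j * v j := by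
        rw [sum_bilinear_factor (fun j (x : Fin t × Fin n) => c j x.1 x.2) (fun x l => S x.1 x.2 l) v,
          sum_bilinear_factor (fun j q => c' j q) (fun q l => Λ q l) v, Finset.sum_congr rfl fun j _ => hdiag j]
    _ = _ := by rw [Fintype.sum_prod_type' (fun r i => (∑ j, c j r i * v j) * (∑ l, S r i l * v l))]

end Bilinear

section Factor

variable (S : Fin t → Fin n → Fin n → F) (Λ : Fin k → Fin n → F) (θ : Fin t → F) (Fs I : Finset (Fin n))
  (c : Fin n → Fin t → Fin n → F) (c' : Fin n → Fin k → F) (s : Fin n → Fin n → F)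

/-- the index of the linear forms of the bilinear normal form: two per (pencil member, point of `I`), two per label row, and one
diagonal form -/
abbrev PencilIndex (t : ℕ) (I : Finset (Fin n)) (k : ℕ) : Type := ((Fin t × I) ⊕ (Fin t × I)) ⊕ ((Fin k ⊕ Fin k) ⊕ Unit)

/-- the normal form uses `2·t·|I| + 2·k + 1` linear forms -/
theorem card_pencilIndex : Fintype.card (PencilIndex t I k) = 2 * (t * I.card) + 2 * k + 1 := by
  simp only [PencilIndex, Fintype.card_sum, Fintype.card_prod, Fintype.card_fin, Fintype.card_coe, Fintype.card_unit]
  ring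

/-- the linear forms of the normal form (as coefficient vectors) -/
def pencilForms : PencilIndex t I k → (Fin n → F)
  | Sum.inl (Sum.inl x) => fun j => c j x.1 x.2
  | Sum.inl (Sum.inr x) => fun l => S x.1 x.2 l
  | Sum.inr (Sum.inl (Sum.inl q)) => fun j => c' j q
  | Sum.inr (Sum.inl (Sum.inr q)) => fun l => Λ q l
  | Sum.inr (Sum.inr _) => fun j => s j j

/-- the outer function of the normal form: sum of the products of the paired form values, plus the diagonal form value -/
def pencilRead (t : ℕ) (I : Finset (Fin n)) (k : ℕ) (f : PencilIndex t I k → F) : F :=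
  (∑ x : Fin t × I, f (Sum.inl (Sum.inl x)) * f (Sum.inl (Sum.inr x)))
    + (∑ q : Fin k, f (Sum.inr (Sum.inl (Sum.inl q))) * f (Sum.inr (Sum.inl (Sum.inr q)))) + f (Sum.inr (Sum.inr ()))

/-- **the `θ`-member is a function of `2·t·|I| + 2·k + 1` linear forms** at the Boolean points of the subcube on `Fs`:
with the rows structured over `I` (coefficients `c j` supported in `I`) and pair-free light parts on `Fs`, the value
`Σ_{j,l} v_j (Σ_r θ_r S r j l) v_l` at a `0/1`-vector `v` supported on `Fs` is `pencilRead` of the values of the `pencilForms`. -/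
theorem pencil_factor
    (hrow : ∀ j ∈ Fs, ∀ l ∈ Fs, (∑ r, θ r * S r j l) = (∑ r, ∑ i, c j r i * S r i l) + (∑ q, c' j q * Λ q l) + s j l)
    (hpf : ∀ j ∈ Fs, ∀ l ∈ Fs, l ≠ j → s j l = 0) (hc : ∀ j r i, i ∉ I → c j r i = 0)
    (v : Fin n → F) (hv : ∀ l, l ∉ Fs → v l = 0) (hv01 : ∀ l, v l = 0 ∨ v l = 1) :
    (∑ j, ∑ l, v j * (∑ r, θ r * S r j l) * v l) =
      pencilRead t I k (fun x => ∑ l, pencilForms S Λ I c c' s x l * v l) := by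
  rw [pencil_bilinear S Λ θ Fs c c' s hrow hpf v hv]
  have hsq : ∀ j, s j j * v j * v j = s j j * v j := fun j => by rcases hv01 j with h | h <;> simp [h]
  -- the summand of the first block, and its collapse from `Fin n` to `I`
  set g : Fin t → Fin n → F := fun r i => (∑ j, c j r i * v j) * (∑ l, S r i l * v l) with hg
  have hvan : ∀ r i, i ∉ I → g r i = 0 := by
    intro r i hi
    simp only [hg, hc _ r i hi, zero_mul, Finset.sum_const_zero]
  have hcollapse : ∀ r, ∑ i, g r i = ∑ y : I, g r y := by
    intro r
    rw [← Finset.sum_subset (Finset.subset_univ I) (fun i _ hi => hvan r i hi), Finset.sum_coe_sort]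
  have hR : (∑ x : Fin t × I, (∑ j, c j x.1 x.2 * v j) * (∑ l, S x.1 x.2 l * v l)) = ∑ r, ∑ i, g r i := by
    rw [Fintype.sum_prod_type]
    exact Finset.sum_congr rfl fun r _ => (hcollapse r).symm
  unfold pencilRead
  simp only [pencilForms]
  rw [hR, Finset.sum_congr rfl fun j _ => hsq j]

end Factor

section Substitution

/-- **pencil substitution (PS).**  If `θ r₀ ≠ 0`, the `r₀`-th of `t` quantities is an explicit function of the `θ`-combination
and the other `t − 1`: a register reading `q_1, …, q_t` reads `Σ_r θ_r q_r` and the `q_r`, `r ≠ r₀`, instead. -/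
theorem pencil_solve {X : Type*} (θ : Fin t → F) (r₀ : Fin t) (hθ : θ r₀ ≠ 0) (q : Fin t → X → F) (Φ : X → F)
    (hΦ : ∀ x, ∑ r, θ r * q r x = Φ x) (x : X) :
    q r₀ x = (θ r₀)⁻¹ * (Φ x - ∑ r ∈ univ.erase r₀, θ r * q r x) := by
  have h := hΦ x
  rw [← Finset.add_sum_erase _ _ (mem_univ r₀)] at h
  have h' : θ r₀ * q r₀ x = Φ x - ∑ r ∈ univ.erase r₀, θ r * q r x := eq_sub_of_add_eq h
  rw [← h', ← mul_assoc, inv_mul_cancel₀ hθ, one_mul]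

/-- the substituted reading: a function `H` of the `t` quantities equals a function of (the `θ`-combination, the quantities
with `q r₀` overwritten arbitrarily) — here packaged as: `H` applied to `q` equals `H` applied to `q` with its `r₀`-entry
replaced by the solved expression. -/
theorem pencil_substitute {X Y : Type*} (θ : Fin t → F) (r₀ : Fin t) (hθ : θ r₀ ≠ 0) (q : Fin t → X → F) (Φ : X → F)
    (hΦ : ∀ x, ∑ r, θ r * q r x = Φ x) (H : X → (Fin t → F) → Y) (x : X) :
    H x (fun r => q r x) =
      H x (Function.update (fun r => q r x) r₀ ((θ r₀)⁻¹ * (Φ x - ∑ r ∈ univ.erase r₀, θ r * q r x))) := by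
  congr 1
  funext r
  by_cases hr : r = r₀
  · subst hr
    rw [Function.update_self]
    exact pencil_solve θ r hθ q Φ hΦ x
  · rw [Function.update_of_ne hr]

end Substitution

end Summit.QuantumAdvantage.QuantumAdvantage.Theorems.JointFreeness
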